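import Summits.CriticalPhenomena.SAWScalingLimit.Theorems.SAWDevelopingMapObservableToSLETypeLadderCarvedReductionSqueezeZonesDef
import HarnessLib

/-!
# The zone sequences `Z_n ⊆ Z'_n`, `X_n` of the squeeze: monotonicity, margins, density, and the
# persistence margin of the reach clause (piece (T-A′₂F zone sequences) of stub T-A′₂F
# `stub_carvedReduction_squeezeGeometry_domainsCoreF`)

Crux `SAWDevelopingMap.ObservableToSLE` (stmt-CriticalPhenomena-10472), line `six-class-type-ladder`,
stub T-A′₂F `stub_carvedReduction_squeezeGeometry_domainsCoreF`.  Landing target: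
`Summits/CriticalPhenomena/SAWScalingLimit/Theorems/SAWDevelopingMapObservableToSLETypeLadderCarvedReductionSqueezeZonesSeq.lean`.

With `εₙ = ε₀/2ⁿ`, `cₙ = c₀/2ⁿ` (`epsSeq`): `Z_n := zoneAt (4εₙ) cₙ`, `Z'_n := zoneAt (2εₙ) (cₙ/2)`,
`X_n := XAt (4εₙ)`.  This file supplies the index bookkeeping of `outerSeq` for these sequences
(`Z_n ⊆ Z'_n`, `Z'` monotone, `X_{n+1}` off `closure Z'_n`, the margins, the local boundary
structure at every `n`), the DENSITY hypothesis of the kernel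
(`frontier Ω ∩ E ⊆ closure (⋃ n, Z_n ∩ E)`, `frontier_subset_closure_iUnion_zone`: points of the
limit cells are approached through the zones by `exists_near_mem_sideZone`, points of
`closure Kᶜ` through the collars by `exists_mem_collarZone`; and
`frontier_component_subset_compl`: the frontier of a component of an open set lies off the set),
and the persistence margin of the reach transfer (`eventually_not_mem_closure_zoneAt`).
Registered carrier: `stub_carvedReduction_zonesSeq`.
-/

noncomputable section

open scoped Topology
open Filter Set Metric
open Literature.Probability.LatticeModels (HexVertex hexGraph hexCenter triEmbed Site)
open Literature.Probability.RandomPlanarGeometry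

namespace Summit.CriticalPhenomena.SAWScalingLimit.Theorems.ObservableToSLE.TypeLadder

open Summit.CriticalPhenomena.SAWScalingLimit.Theorems.ObservableToSLER.BridgeGate

/-! ### The geometric sequence -/

/-- `ε₀ / 2ⁿ`. -/
def epsSeq (ε₀ : ℝ) (n : ℕ) : ℝ := ε₀ / 2 ^ n

/-- `epsSeq` is positive. -/
theorem epsSeq_pos {ε₀ : ℝ} (h : 0 < ε₀) (n : ℕ) : 0 < epsSeq ε₀ n := by unfold epsSeq; positivity

/-- `epsSeq` halves at each step. -/
theorem epsSeq_succ (ε₀ : ℝ) (n : ℕ) : epsSeq ε₀ (n + 1) = epsSeq ε₀ n / 2 := by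
  unfold epsSeq; rw [pow_succ]; ring

/-- `epsSeq ≤ ε₀`. -/
theorem epsSeq_le {ε₀ : ℝ} (h : 0 ≤ ε₀) (n : ℕ) : epsSeq ε₀ n ≤ ε₀ := by
  unfold epsSeq
  exact div_le_self h (one_le_pow₀ (by norm_num))

/-- `epsSeq` is antitone. -/
theorem epsSeq_antitone {ε₀ : ℝ} (h : 0 ≤ ε₀) : Antitone (epsSeq ε₀) := by
  refine antitone_nat_of_succ_le fun n => ?_
  rw [epsSeq_succ]
  have := div_nonneg h (pow_nonneg (by norm_num : (0 : ℝ) ≤ 2) n)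
  unfold epsSeq at this ⊢
  linarith

/-- The sequence gets below every positive number. -/
theorem exists_epsSeq_lt (ε₀ : ℝ) {r : ℝ} (hr : 0 < r) : ∃ n, epsSeq ε₀ n < r := by
  obtain ⟨n, hn⟩ := exists_nat_gt (ε₀ / r)
  refine ⟨n, ?_⟩
  unfold epsSeq
  have h2n : (n : ℝ) + 1 ≤ 2 ^ n := by
    have := Nat.lt_two_pow_self (n := n)
    exact_mod_cast this
  have hpos : (0 : ℝ) < 2 ^ n := by positivity
  rw [div_lt_iff₀ hpos]
  rw [div_lt_iff₀ hr] at hn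
  nlinarith

/-! ### The frontier of a component -/

/-- The frontier of a component of an open set lies off the set. -/
theorem frontier_component_subset_compl {O : Set ℂ} (hO : IsOpen O) (b : ℂ) :
    frontier (connectedComponentIn O b) ⊆ Oᶜ := by
  intro p hp hpO
  have hC : IsOpen (connectedComponentIn O b) := hO.connectedComponentIn
  rw [frontier, hC.interior_eq] at hp
  obtain ⟨hpcl, hpC⟩ := hp
  -- the component of `p` is an open neighbourhood of `p` meeting the component of `b`
  have hCp : IsOpen (connectedComponentIn O p) := hO.connectedComponentIn
  obtain ⟨q, hqp, hqC⟩ := mem_closure_iff_nhds.1 hpcl _ (hCp.mem_nhds (mem_connectedComponentIn hpO))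
  have h1 : connectedComponentIn O p = connectedComponentIn O q := connectedComponentIn_eq hqp
  have h2 : connectedComponentIn O b = connectedComponentIn O q := connectedComponentIn_eq hqC
  exact hpC (by rw [h2, ← h1]; exact mem_connectedComponentIn hpO)

section Seq

variable {N : ℕ} {P : Fin 2 → ℂ} {ρ : ℝ} {Ksp Bd : Fin 2 → Set ℂ} {cell conn : Fin 2 → Fin N → ℂ × ℝ}
  {K : Set ℂ} {zf : ℂ} {Ω E : Set ℂ} {ε₀ c₀ : ℝ}

/-! ### Bookkeeping of the sequences -/

/-- `0 ≤ epsSeq`. -/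
theorem epsSeq_nonneg' {a : ℝ} (h : 0 ≤ a) (n : ℕ) : 0 ≤ epsSeq a n := div_nonneg h (pow_nonneg (by norm_num) n)

/-- `Z_n ⊆ Z'_n`. -/
theorem zoneSeq_subset (hε : 0 ≤ ε₀) (hc : 0 ≤ c₀) (n : ℕ) :
    zoneAt P ρ Ksp Bd cell conn K zf (4 * epsSeq ε₀ n) (epsSeq c₀ n) ⊆
      zoneAt P ρ Ksp Bd cell conn K zf (2 * epsSeq ε₀ n) (epsSeq c₀ n / 2) :=
  zoneAt_mono (by linarith [epsSeq_nonneg' hε n]) (by linarith [epsSeq_nonneg' hc n])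

/-- `Z'` is monotone. -/
theorem zoneSeq'_monotone (hε : 0 ≤ ε₀) (hc : 0 ≤ c₀) :
    Monotone fun n => zoneAt P ρ Ksp Bd cell conn K zf (2 * epsSeq ε₀ n) (epsSeq c₀ n / 2) := by
  refine monotone_nat_of_le_succ fun n => ?_
  refine zoneAt_mono ?_ ?_
  · rw [epsSeq_succ]; linarith [epsSeq_nonneg' hε n]
  · rw [epsSeq_succ]; linarith [epsSeq_nonneg' hc n]

/-- The margin `dist (Z_n ∩ E, E ∖ Z'_n) ≥ d_n > 0`. -/
theorem zoneSeq_margin (hε : 0 < ε₀) (hc : 0 < c₀) (n : ℕ) :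
    ∃ d > (0 : ℝ), ∀ a ∈ zoneAt P ρ Ksp Bd cell conn K zf (4 * epsSeq ε₀ n) (epsSeq c₀ n) ∩ E,
      ∀ b ∈ E \ zoneAt P ρ Ksp Bd cell conn K zf (2 * epsSeq ε₀ n) (epsSeq c₀ n / 2), d ≤ dist a b := by
  refine ⟨min (2 * epsSeq ε₀ n) (epsSeq c₀ n / 2), lt_min (by linarith [epsSeq_pos hε n]) (by linarith [epsSeq_pos hc n]),
    fun a ha b hb => ?_⟩
  have := le_dist_zoneAt (2 * epsSeq ε₀ n) (epsSeq c₀ n) a (by rwa [show 2 * (2 * epsSeq ε₀ n) = 4 * epsSeq ε₀ n by ring]) b hb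
  exact this

/-- `X_{n+1}` misses `closure (Z'_n ∩ E)` and `X_n` misses `closure (Z_n ∩ E)` (`ε₀ ≤ ρ/16`). -/
theorem XSeq_disjoint (hΩ0 : ∀ i, Disjoint Ω (sideZone (P i) ρ (Ksp i) (Bd i) (cell i) (conn i) 0))
    (hΩK : Ω ⊆ K) (hwin : ∀ i, {z : ℂ | (P i).im < z.im} ∩ ball (P i) (ρ / 2) ⊆ Ω)
    (hballK : ∀ i, ball (P i) (ρ / 2) ⊆ K) (hρ : 0 < ρ) (hε : 0 < ε₀) (hερ : ε₀ ≤ ρ / 16) (hc : 0 < c₀) (n : ℕ) :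
    Disjoint (XAt Ω P ρ (4 * epsSeq ε₀ n)) (closure (zoneAt P ρ Ksp Bd cell conn K zf (4 * epsSeq ε₀ n) (epsSeq c₀ n) ∩ E)) ∧
    Disjoint (XAt Ω P ρ (4 * epsSeq ε₀ (n + 1)))
      (closure (zoneAt P ρ Ksp Bd cell conn K zf (2 * epsSeq ε₀ n) (epsSeq c₀ n / 2) ∩ E)) := by
  have h4 : 4 * epsSeq ε₀ n ≤ ρ / 4 := by linarith [epsSeq_le hε.le n]
  refine ⟨disjoint_XAt_closure_zoneAt hΩ0 hΩK hwin hballK hρ (by linarith [epsSeq_pos hε n]) le_rfl h4 (epsSeq_pos hc n), ?_⟩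
  rw [show 4 * epsSeq ε₀ (n + 1) = 2 * epsSeq ε₀ n by rw [epsSeq_succ]; ring]
  exact disjoint_XAt_closure_zoneAt hΩ0 hΩK hwin hballK hρ (by linarith [epsSeq_pos hε n]) le_rfl (by linarith)
    (by linarith [epsSeq_pos hc n])

/-! ### Density for the kernel -/

/-- **DENSITY OF THE ZONES AT THE FRONTIER OF THE BULK**: if `frontier Ω ∩ E` lies in the closed
limit cells and the closure of `Kᶜ`, then it lies in `closure (⋃ n, Z_n ∩ E)`. -/
theorem frontier_subset_closure_iUnion_zone (hE : IsOpen E)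
    (hfr : frontier Ω ∩ E ⊆ (⋃ i : Fin 2, ⋃ a : Fin N, {z : ℂ | ∀ ℓ : Fin 3, |skewCoord ℓ (z - (cell i a).1)| ≤ (cell i a).2}) ∪ closure Kᶜ)
    (hdense : ∀ (i : Fin 2) (a : Fin N) (p : ℂ), (∀ ℓ : Fin 3, |skewCoord ℓ (p - (cell i a).1)| ≤ (cell i a).2) → ∀ r > (0 : ℝ),
      ∃ s > (0 : ℝ), ∃ y ∈ sideZone (P i) ρ (Ksp i) (Bd i) (cell i) (conn i) s, dist y p < r)
    (hK : IsCompact K) (hKne : K.Nonempty) (hKc : IsPreconnected Kᶜ) (hzf : zf ∉ K) :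
    frontier Ω ∩ E ⊆ closure (⋃ n, zoneAt P ρ Ksp Bd cell conn K zf (4 * epsSeq ε₀ n) (epsSeq c₀ n) ∩ E) := by
  intro p hp
  have hpE : p ∈ E := hp.2
  obtain ⟨r₁, hr₁, hball⟩ := Metric.isOpen_iff.1 hE p hpE
  rw [Metric.mem_closure_iff]
  intro r hr
  rcases hfr hp with hcell | hcol
  · rw [mem_iUnion] at hcell
    obtain ⟨i, hcell⟩ := hcell
    rw [mem_iUnion] at hcell
    obtain ⟨a, ha⟩ := hcell
    obtain ⟨s, hs, y, hy, hyp⟩ := hdense i a p ha (min r r₁) (lt_min hr hr₁)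
    obtain ⟨n, hn⟩ := exists_epsSeq_lt ε₀ (show 0 < s / 4 by positivity)
    refine ⟨y, mem_iUnion.2 ⟨n, ?_, hball (mem_ball.2 (hyp.trans_le (min_le_right _ _)))⟩, ?_⟩
    · have hy' : y ∈ sideZone (P i) ρ (Ksp i) (Bd i) (cell i) (conn i) (4 * epsSeq ε₀ n) := sideZone_antitone (by linarith) hy
      fin_cases i
      · exact Or.inl (Or.inl hy')
      · exact Or.inl (Or.inr hy')
    · rw [dist_comm]; exact hyp.trans_le (min_le_left _ _)
  · obtain ⟨z, hzK, hzp⟩ := Metric.mem_closure_iff.1 hcol (min r r₁) (lt_min hr hr₁)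
    obtain ⟨c, hcpos, hzc⟩ := exists_mem_collarZone hK hKne hKc hzf hzK
    obtain ⟨n, hn⟩ := exists_epsSeq_lt c₀ hcpos
    refine ⟨z, mem_iUnion.2 ⟨n, Or.inr (collarZone_mono hn.le hzc), hball (mem_ball.2 ?_)⟩, hzp.trans_le (min_le_left _ _)⟩
    rw [dist_comm]; exact hzp.trans_le (min_le_right _ _)

/-! ### The persistence margin of the reach clause -/

/-- **THE PERSISTENCE MARGIN FOR THE ZONE**: eventually, every point within `m` of a present vertex
pinned from `closure D₀` is off `closure (Z(σ, c) ∩ E)` (`2m ≤ σ`, `2m < c`; pinned points drift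
by `s_j triEmbed (x j) → τ`, `K = closure (D₀ - τ)`). -/
theorem eventually_not_mem_closure_zoneAt {s : ℕ → ℝ} {x : ℕ → Site 2} {U : ℕ → Set HexVertex} {D₀ : Set ℂ} {τ : ℂ}
    (hK : K = closure ((fun z => z - τ) '' D₀))
    (hτ : Tendsto (fun j => (s j : ℂ) * triEmbed (x j)) atTop (𝓝 τ))
    (hside : ∀ i, ∀ σ > (0 : ℝ), ∀ᶠ j in atTop, ∀ v : HexVertex, v ∉ U j → ∀ z : ℂ,
      dist z ((s j : ℂ) * hexCenter v - (s j : ℂ) * triEmbed (x j)) ≤ σ / 2 →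
        z ∉ closure (sideZone (P i) ρ (Ksp i) (Bd i) (cell i) (conn i) σ))
    {σ c m : ℝ} (hσ : 0 < σ) (hc : 0 < c) (hmσ : 2 * m ≤ σ) (hmc : 2 * m < c) :
    ∀ᶠ j in atTop, ∀ v : HexVertex, v ∉ U j → (s j : ℂ) * hexCenter v ∈ closure D₀ → ∀ z : ℂ,
      dist z ((s j : ℂ) * hexCenter v - (s j : ℂ) * triEmbed (x j)) ≤ m →
        z ∉ closure (zoneAt P ρ Ksp Bd cell conn K zf σ c ∩ E) := by
  have hdrift : ∀ᶠ j in atTop, dist ((s j : ℂ) * triEmbed (x j)) τ < (c - 2 * m) / 2 :=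
    (tendsto_iff_dist_tendsto_zero.1 hτ).eventually (gt_mem_nhds (by linarith))
  filter_upwards [hside 0 σ hσ, hside 1 σ hσ, hdrift] with j h0 h1 hdj v hvU hvD z hz hzcl
  have h2 := closure_mono inter_subset_left hzcl
  rw [zoneAt, closure_union, closure_union] at h2
  rcases h2 with (h | h) | h
  · exact h0 v hvU z (by linarith) h
  · exact h1 v hvU z (by linarith) h
  · have h3 := le_infDist_of_mem_closure_collarZone h
    -- the pinned vertex is within the drift of `K`
    have h4 : infDist ((s j : ℂ) * hexCenter v - (s j : ℂ) * triEmbed (x j)) K ≤ dist ((s j : ℂ) * triEmbed (x j)) τ := by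
      have hmem : (s j : ℂ) * hexCenter v - τ ∈ K := by
        rw [hK]
        exact image_closure_subset_closure_image (by fun_prop) ⟨_, hvD, rfl⟩
      refine (infDist_le_dist_of_mem hmem).trans (le_of_eq ?_)
      rw [dist_comm, dist_eq_norm, dist_eq_norm]; congr 1; ring
    have h5 := infDist_le_infDist_add_dist (x := z) (y := (s j : ℂ) * hexCenter v - (s j : ℂ) * triEmbed (x j)) (s := K)
    linarith

end Seq

/-- **Registered carrier `stub_carvedReduction_zonesSeq`** (crux item stmt-CriticalPhenomena-10472,
stub T-A′₂F `stub_carvedReduction_squeezeGeometry_domainsCoreF`, piece THE ZONE SEQUENCES): the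
frontier of a component of an open set lies off the set. -/
theorem stub_carvedReduction_zonesSeq :
    ∀ (O : Set ℂ) (b : ℂ), IsOpen O → frontier (connectedComponentIn O b) ⊆ Oᶜ :=
  fun _ b hO => frontier_component_subset_compl hO b

end Summit.CriticalPhenomena.SAWScalingLimit.Theorems.ObservableToSLE.TypeLadder

end
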